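import Summits.CriticalPhenomena.PercolationContinuityZ3.Theorems.PercNearOneGluingNoHeavyLowerTailMajorityGluingQCertSymParts
import HarnessLib

/-!
# Part 11 of 18 of the orbit certificate of the cell `(12,7)` at `c = 157/100`: data and digest (lane prim-rate, constants-miner 1, gen 36; generated by cert/mksym.py)

Support file for the closed crux `NoHeavyLowerTail` (stmt-CriticalPhenomena-4575), majority-gluing line.  The symmetrised certificate of the cell `(12,7)`
(kit j286395, symcert.py) is checked IN PARTS (`…MajorityGluingQCertSymParts`): this file holds part 11 (1 multiplier terms, 1 marginal slacks,
0 rows, 0 squares; 3636 contributions) and its DIGEST `twelveSevenSymP11D` (57 orbit keys), verified by `decide +kernel` (`twelveSevenSymP11_digest`).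
The parts are glued in `…MajorityGluingQCertSymTwelveSeven`.  No sorries. [cite: VandenbergKahn2001, Thm 1.2 (p. 123)]
-/

namespace Summit.CriticalPhenomena.PercolationContinuityZ3.Theorems

namespace HubOnly
namespace QCert

/-- Row representatives of part 11: `(A, X, B, Y, n, masks of f(A,X), f(B,Y), f(A∪B,X∩Y), f(∅,X∪Y))`. -/
def twelveSevenSymP11Rows : List RowE :=
  []

/-- Square representatives of part 11: `(a, b, n, mask₁, mask₂)`. -/
def twelveSevenSymP11Sqs : List SqE :=
  []

/-- **Part 11** of the `(12,7)` orbit certificate at `157/100`. -/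
def twelveSevenSymP11 : SymCert :=
  ⟨⟨12, 7, 157, 100, 1, [], [], []⟩,
    [(3, 120104606567214368)],
    [(0, 31, 678057920572835968)],
    [twelveSevenSymP11Rows], [twelveSevenSymP11Sqs]⟩

/-- The digest of part 11: `(orbit key, coefficient total)` in increasing key order (computed by cert/mksym.py, verified below). -/
def twelveSevenSymP11D : List (ℕ × ℤ) :=
  [((4128 : ℕ), (678057920572835968 : ℤ)), (12322, 2712231682291343872), (12352, 4746405444009851776), (12418, -3026636085493802073600), 
    (12544, -5044393475823003456000), (12546, -2522196737911501728000), (12799, -1441255278806572416000), (12800, -2882510557613144832000), 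
    (12802, -1441255278806572416000), (13311, -540470729552464656000), (13312, -1080941459104929312000), (13314, -540470729552464656000), 
    (14335, -120104606567214368000), (14336, -240209213134428736000), (14338, -120104606567214368000), (16383, -12010460656721436800), 
    (16384, -24020921313442873600), (16386, -12010460656721436800), (28710, 4068347523437015808), (28738, 18985621776039407104), 
    (28800, 14239216332029555328), (61486, 2712231682291343872), (61510, 28478432664059110656), (61570, 56956865328118221312), 
    (61696, 23732027220049258880), (127038, 678057920572835968), (127054, 18985621776039407104), (127070, 4746405444009851776), 
    (127110, 85435297992177331968), (127118, 56956865328118221312), (127134, 14239216332029555328), (127234, 94928108880197035520), 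
    (127238, 142392163320295553280), (127246, 94928108880197035520), (127262, 23732027220049258880), (127488, 23732027220049258880), 
    (127490, 94928108880197035520), (127494, 142392163320295553280), (127502, 94928108880197035520), (127518, 23732027220049258880), 
    (128000, 14239216332029555328), (128002, 56956865328118221312), (128006, 85435297992177331968), (128014, 56956865328118221312), 
    (128030, 14239216332029555328), (129024, 4746405444009851776), (129026, 18985621776039407104), (129030, 28478432664059110656), 
    (129038, 18985621776039407104), (129054, 4746405444009851776), (131072, 678057920572835968), (131074, 2712231682291343872), 
    (131078, 4068347523437015808), (131086, 2712231682291343872), (131102, 678057920572835968), (16781315, 18856423231052655776), 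
    (16781343, -678057920572835968)]

/-- **The digest of part 11 is `twelveSevenSymP11D`** (kernel evaluation of the part's 3636 contributions). -/
theorem twelveSevenSymP11_digest : twelveSevenSymP11.digest 20 = twelveSevenSymP11D := by
  decide +kernel

end QCert
end HubOnly

end Summit.CriticalPhenomena.PercolationContinuityZ3.Theorems
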